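import Mathlib
import Summits.NavierStokesRegularity.NavierStokesRegularity.Theses.ImplosionDoor
import HarnessLib

/-!
# `ImplosionDoor.Assembly` — the route's assembly (item stmt-NavierStokesRegularity-25309;
  pure logic)

**Statement.** `ImplosionZoom → SphereFluxTangency → PassiveRadialVorticity →
TangentialCurlFreeTriviality → Target` (the rung leaf of the implosion door).

PROOF. The route file `Theses/ImplosionDoor.lean` carries the planner-authored, kernel-checked
deciding theorem `Theses.ImplosionDoor.closes` (hypotheses: the two cruxes and the two supports;
conclusion: `Target`): at a point that is not backward bounded the zoom (`ImplosionZoom`) gives a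
Type-I ancient Oseen-mild profile with imploding slices, `SphereFluxTangency` makes it
sphere-tangential, `PassiveRadialVorticity` kills the radial vorticity moment and
`TangentialCurlFreeTriviality` denies the backward singularity. The assembly item is that
implication written as ONE proposition (hypotheses in the item's order), so it is closed by
applying `closes`.

HONEST FRAMING: glue between the route's own statements about a HYPOTHETICAL Type-I profile; the
two cruxes are OPEN and stay hypotheses; the door is a criterion, not a regularity theorem.
Nothing here proves or refutes Navier–Stokes regularity.
-/

noncomputable section

set_option linter.dupNamespace false

namespace Summit.NavierStokesRegularity.NavierStokesRegularity.Theorems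

open Summit.NavierStokesRegularity.NavierStokesRegularity.Theses.ImplosionDoor in
/-- **Item stmt-NavierStokesRegularity-25309** (`ImplosionDoor.Assembly`): the route's two
supports and two cruxes imply its rung leaf `Target`, by the route file's deciding theorem
`closes`. [this file] -/
theorem implosionDoor_assembly_proof :
    Summit.NavierStokesRegularity.NavierStokesRegularity.Theses.ImplosionDoor.Assembly := by
  unfold Summit.NavierStokesRegularity.NavierStokesRegularity.Theses.ImplosionDoor.Assembly
  intro h₉ h₈ h₂ h₃
  exact closes h₂ h₃ h₈ h₉

end Summit.NavierStokesRegularity.NavierStokesRegularity.Theorems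

end
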